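/-
Copyright (c) 2026 the pub-hodgecm-mathlib formalisation cell (harness21).  Prover seat hodgecm-mathlib-K2E1b-p01 (g3), Track B «K2-LIT» ∕ h413
(`stmt-HodgeConjecture-24833`), line `K2_E3_EllipticInputs`, unit U12 «HC characters», socket U12-h ‹#9L›: the brick (Dict) of the 9L line lead's FRAME ASSEMBLY SPEC
(K2E3-p09 (g2), MEMO v5 `K2/K2E3-p09/g2/MEMO-U12h-frame-assembly.v5.K2E3-p09-g2.md`).  2026-09-04.
-/
import Literature.NumberTheory.Automorphic.GLnCongruenceSubgroups        -- ★ `ValBound`, `congruenceGL`, `mem_congruenceGL_iff`; brings ★ `glInt`, `mem_glInt_iff`, `IsUniformizingElement`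
import Literature.NumberTheory.Automorphic.AdicCompletionLocalField      -- ★ `ValuativeRel` ∕ `Valued.v.Compatible` ∕ `LocallyCompactSpace` on `L_w`; brings Mathlib `instRankOneAdicCompletion`
import Summits.HodgeConjecture.HodgeConjecture.Theorems.K2E3RegularAdjointConeEstimates   -- ★ p855727 (K2E3-p09): `norm_conj_sub_le_of_le`; brings ★ `Literature.Analysis.Matrix.norm_mul_le_of_isUltrametricDist`
import Mathlib.Topology.Algebra.Valued.NormedValued
import Mathlib.Analysis.Matrix.Normed
import Mathlib.Analysis.Normed.Field.ProperSpace
import Mathlib.FieldTheory.Perfect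
import HarnessLib

/-!
# K2_E3 road (h413 = stmt-HodgeConjecture-24833), U12-h ‹#9L› frame assembly, brick (Dict): THE LOCAL-FIELD NORM DICTIONARY
# `ValBound (v ϖ^m)^{∓1} X ↔ ‖X‖ ≤ q^{±m}`, `GL_n(𝒪)` and `K_m` in norms, `hval`, `ProperSpace`

Cell `pub/hodgecm-mathlib` (D-0151), Track B; 9L line lead K2E3-p09 (g2), dealt by name 2026-09-03T23:55:34Z.  The ★ generic road to ‹#9L›
(★ p855853 `exists_nhds_levelTraceStable_of_bricks_defect` ⟸ … ⟸ ★ p855210) is written in the currency of a normed field `F` and the ELEMENTWISE sup norm on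
`𝔤 = Matrix (Fin N) (Fin N) F` (Mathlib's scoped instance `open scoped Matrix.Norms.Elementwise`, as in ★ `K2E3RegularAdjointConeEstimates`), while the congruence
frame (★ p855816 `frame_pack`, ★ `GLnCongruenceSubgroups`) speaks `ValBound γ X` ∕ `congruenceGL n (valuation F ϖ ^ m)` ∕ `glInt n F` for the valuation
`valuation F` of a `ValuativeRel`.  At a place, `F = L_w = w.adicCompletion L` carries Mathlib's `Valued F ℤᵐ⁰` (rank one: Mathlib `instRankOneAdicCompletion`), the norm
`‖·‖` of `Valued.toNormedField` ∕ `Valued.toNontriviallyNormedField` (Mathlib, scoped instances of `open scoped Valued`; the `letI` of ★ `K2E3CayleySliceConjugatesNhdsNonsplit`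
is the same term), and ★ `AdicCompletionLocalField`'s `ValuativeRel` with `Valued.v.Compatible`.  THIS FILE is the dictionary between the two currencies, stated for ANY
field with a `ValuativeRel`, a compatible rank-one `Valued` structure and the norm it defines (so it applies verbatim at every `L_w`):

* §1 scalars: `valuation F x ≤ valuation F y ↔ ‖x‖ ≤ ‖y‖` (and `<`, `≤ 1`, `< 1`, `∈ 𝒪 ↔ ‖·‖ ≤ 1`); `1 < q := ‖ϖ‖⁻¹` for `v ϖ < 1`, `ϖ ≠ 0` (in particular for a uniformizer).
* §2 matrices (`hval` and the bounds): `exists_ne_zero_and_norm_eq` — **`Y ≠ 0 ⇒ ∃ a ≠ 0, ‖Y‖ = ‖a‖`** (`a` an entry of maximal norm; any normed group of entries);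
  `valBound_valuation_iff_norm_le` — **`ValBound (valuation F a) X ↔ ‖X‖ ≤ ‖a‖`**, whence `ValBound 1 X ↔ ‖X‖ ≤ 1`, **`ValBound (valuation F ϖ ^ m) X ↔ ‖X‖ ≤ (q^m)⁻¹`**,
  **`ValBound (valuation F ϖ ^ m)⁻¹ X ↔ ‖X‖ ≤ q^m`**.
* §3 groups: **`k ∈ glInt n F ↔ ‖k‖ ≤ 1 ∧ ‖k⁻¹‖ ≤ 1`**; **`k ∈ congruenceGL n (valuation F ϖ ^ m) ↔ (‖k‖ ≤ 1 ∧ ‖k⁻¹‖ ≤ 1) ∧ ‖k − 1‖ ≤ (q^m)⁻¹ ∧ ‖k⁻¹ − 1‖ ≤ (q^m)⁻¹`** and the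
  forward packet `norm_bounds_of_mem_congruenceGL_pow`.
* §4 the instance facts the ★ L6-inst files take as binders, as THEOREMS (no `instance` is declared): `properSpace_of_locallyCompactSpace` (Mathlib
  `ProperSpace.of_nontriviallyNormedField_of_weaklyLocallyCompactSpace`), `isUltrametricDist` (Mathlib), and at `L_w`: `ProperSpace L_w` is ALREADY ★ `Literature.NumberTheory.Automorphic.properSpace_adicCompletion`
  (`AdicCompletionCompact`), `perfectField_adicCompletion` (`CharZero`, ★ `charZero_adicCompletion` exists in `Literature.NumberTheory.GaloisRepresentations.PadicAlgebraOfLocalField`; here re-derived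
  inline from the injectivity of `algebraMap L L_w`); `CompleteSpace L_w` is Mathlib's instance for the SAME uniform structure (`Valued.toNormedField` keeps
  `toUniformSpace := Valued.toUniformSpace`), so nothing needs stating.

THEOREMS ONLY (no definition ∕ instance ∕ notation ∕ named fact ∕ `sorry`); `--supports stmt-HodgeConjecture-24833 --as helper`.  HONEST LABEL: HC_CM is proved only modulo the
7 printed citations (2 remaining named inputs: hLiu418 = stmt-HodgeConjecture-24832, h413 = stmt-HodgeConjecture-24833) until rung 0 closes; count-neutral plumbing.

## References
* [HarishChandra1999AdmissibleDistributions] Harish-Chandra (DeBacker–Sally), *Admissible Invariant Distributions on Reductive p-adic Groups*, ULECT 16 (1999), §17 p. 80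
  (the lattice filtration `K_m`, `‖·‖` on `𝔤`).
* [Casselman1995] W. Casselman, *Introduction to the theory of admissible representations of p-adic reductive groups* (1995), §1.4.
* [WeilBNT1967] A. Weil, *Basic Number Theory* (1967), Ch. I §4, Ch. III §1 (p-fields: the module `q`, local compactness).
-/

set_option autoImplicit false
-- the mandated namespace repeats the single-problem summit's segment (`HodgeConjecture.HodgeConjecture`), as in every `Theorems/*.lean` of this sub-problem
set_option linter.dupNamespace false

noncomputable section

open scoped MatrixGroups Matrix.Norms.Elementwise Valued NNReal
open Literature.NumberTheory.Automorphic

namespace Summit.HodgeConjecture.HodgeConjecture.Cruxes.H413.K2E3LocalFieldNormDictionary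

/-! ## §0 `hval`: a non-zero matrix has the norm of one of its (non-zero) entries -/

section Entry

variable {α : Type*} [NormedAddCommGroup α] {m n : Type*} [Fintype m] [Fintype n]

/-- For the elementwise sup norm, some entry realises the norm of a matrix with non-empty index types. [folklore] -/
theorem exists_norm_eq_norm_entry [Nonempty m] [Nonempty n] (Y : Matrix m n α) : ∃ i j, ‖Y‖ = ‖Y i j‖ := by
  obtain ⟨p, -, hp⟩ := Finset.exists_max_image Finset.univ (fun p : m × n => ‖Y p.1 p.2‖) Finset.univ_nonempty
  refine ⟨p.1, p.2, le_antisymm ?_ (Matrix.norm_entry_le_entrywise_sup_norm Y)⟩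
  exact (Matrix.norm_le_iff (norm_nonneg _)).2 fun i j => hp (i, j) (Finset.mem_univ _)

/-- **`hval`** (the binder of ★ p855853 ∕ ★ p855781 `depthHalving`): a non-zero matrix has the norm of a non-zero scalar — one of its entries. [folklore] -/
theorem exists_ne_zero_and_norm_eq (Y : Matrix m n α) (hY : Y ≠ 0) : ∃ a : α, a ≠ 0 ∧ ‖Y‖ = ‖a‖ := by
  have hne : ‖Y‖ ≠ 0 := norm_ne_zero_iff.2 hY
  rcases isEmpty_or_nonempty m with hm | hm
  · exact absurd (Subsingleton.elim Y 0) hY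
  rcases isEmpty_or_nonempty n with hn | hn
  · exact absurd (Subsingleton.elim Y 0) hY
  obtain ⟨i, j, hij⟩ := exists_norm_eq_norm_entry Y
  exact ⟨Y i j, fun h0 => hne (by rw [hij, h0, norm_zero]), hij⟩

end Entry

/-! ## §1 Scalars: `valuation F` versus the norm of the compatible rank-one `Valued` structure -/

section Scalar

variable {F : Type*} [Field F] [ValuativeRel F] {Γ₀ : Type*} [LinearOrderedCommGroupWithZero Γ₀] [Valued F Γ₀]
  [(Valued.v : Valuation F Γ₀).Compatible] [(Valued.v : Valuation F Γ₀).RankOne]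

/-- `v x ≤ v y ↔ ‖x‖ ≤ ‖y‖` (compatibility of `valuation F` and `Valued.v`, Mathlib `Valued.toNormedField.norm_le_iff`). [folklore] -/
theorem valuation_le_iff_norm_le {x y : F} : ValuativeRel.valuation F x ≤ ValuativeRel.valuation F y ↔ ‖x‖ ≤ ‖y‖ := by
  rw [Valued.toNormedField.norm_le_iff, ← (ValuativeRel.valuation F).vle_iff_le, (Valued.v : Valuation F Γ₀).vle_iff_le]

/-- `v x < v y ↔ ‖x‖ < ‖y‖`. [folklore] -/
theorem valuation_lt_iff_norm_lt {x y : F} : ValuativeRel.valuation F x < ValuativeRel.valuation F y ↔ ‖x‖ < ‖y‖ := by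
  rw [Valued.toNormedField.norm_lt_iff, ← (ValuativeRel.valuation F).vlt_iff_lt, (Valued.v : Valuation F Γ₀).vlt_iff_lt]

/-- `v x ≤ 1 ↔ ‖x‖ ≤ 1`. [folklore] -/
theorem valuation_le_one_iff_norm_le_one {x : F} : ValuativeRel.valuation F x ≤ 1 ↔ ‖x‖ ≤ 1 := by
  rw [← (ValuativeRel.valuation F).map_one, valuation_le_iff_norm_le, norm_one]

/-- `v x < 1 ↔ ‖x‖ < 1`. [folklore] -/
theorem valuation_lt_one_iff_norm_lt_one {x : F} : ValuativeRel.valuation F x < 1 ↔ ‖x‖ < 1 := by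
  rw [← (ValuativeRel.valuation F).map_one, valuation_lt_iff_norm_lt, norm_one]

/-- `x ∈ 𝒪 ↔ ‖x‖ ≤ 1` (`𝒪 = (valuation F).integer`, the ring of ★ `glInt` ∕ `mem_glInt_iff`). [folklore] -/
theorem mem_integer_iff_norm_le_one {x : F} : x ∈ (ValuativeRel.valuation F).integer ↔ ‖x‖ ≤ 1 := by
  rw [Valuation.mem_integer_iff, valuation_le_one_iff_norm_le_one]

/-- **`1 < q`**: for `ϖ ≠ 0` with `v ϖ < 1` (e.g. a uniformizer), `q := ‖ϖ‖⁻¹ > 1`. [cite: WeilBNT1967, Ch. I §4] -/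
theorem one_lt_inv_norm {ϖ : F} (h0 : ϖ ≠ 0) (h1 : ValuativeRel.valuation F ϖ < 1) : 1 < ‖ϖ‖⁻¹ :=
  (one_lt_inv₀ (norm_pos_iff.2 h0)).2 (valuation_lt_one_iff_norm_lt_one.1 h1)

/-- `1 < ‖ϖ‖⁻¹` for a uniformizing element (★ `IsUniformizingElement`). [cite: WeilBNT1967, Ch. I §4] -/
theorem one_lt_inv_norm_of_isUniformizingElement {ϖ : F} (hϖ : IsUniformizingElement ϖ) : 1 < ‖ϖ‖⁻¹ :=
  one_lt_inv_norm hϖ.ne_zero hϖ.valuation_lt_one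

omit [ValuativeRel F] [(Valued.v : Valuation F Γ₀).Compatible] in
/-- `0 < ‖ϖ‖⁻¹ ^ m` and `‖ϖ‖ ^ m = (‖ϖ‖⁻¹ ^ m)⁻¹` — the two spellings `q^{-m}` used below. [folklore] -/
theorem norm_pow_eq_inv_pow_inv (ϖ : F) (m : ℕ) : ‖ϖ‖ ^ m = (‖ϖ‖⁻¹ ^ m)⁻¹ := by
  rw [inv_pow, inv_inv]

omit [ValuativeRel F] [(Valued.v : Valuation F Γ₀).Compatible] in
/-- `IsUltrametricDist F` for the norm of a valuation (Mathlib instance, recorded as a theorem for `haveI`). [folklore] -/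
theorem isUltrametricDist : IsUltrametricDist F := inferInstance

omit [ValuativeRel F] [(Valued.v : Valuation F Γ₀).Compatible] in
/-- **`ProperSpace F`** for the norm of a rank-one valuation on a locally compact field (Mathlib `ProperSpace.of_nontriviallyNormedField_of_weaklyLocallyCompactSpace`;
the binder `[ProperSpace K]` of ★ `K2E3RegularAdjointConeEstimates` §4). [cite: WeilBNT1967, Ch. I §4] -/
theorem properSpace_of_locallyCompactSpace [LocallyCompactSpace F] : ProperSpace F :=
  ProperSpace.of_nontriviallyNormedField_of_weaklyLocallyCompactSpace F

end Scalar

/-! ## §2 Matrices: `ValBound` versus the elementwise sup norm -/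

section MatrixBounds

variable {F : Type*} [Field F] [ValuativeRel F] {Γ₀ : Type*} [LinearOrderedCommGroupWithZero Γ₀] [Valued F Γ₀]
  [(Valued.v : Valuation F Γ₀).Compatible] [(Valued.v : Valuation F Γ₀).RankOne] {m : Type*} [Fintype m]

/-- **THE DICTIONARY**: `ValBound (valuation F a) X ↔ ‖X‖ ≤ ‖a‖` (entrywise `v X_{ij} ≤ v a` ↔ sup-norm bound, Mathlib `Matrix.norm_le_iff`).
[cite: HarishChandra1999AdmissibleDistributions, §17 p. 80] -/
theorem valBound_valuation_iff_norm_le (a : F) (X : Matrix m m F) : ValBound (ValuativeRel.valuation F a) X ↔ ‖X‖ ≤ ‖a‖ := by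
  unfold ValBound
  rw [Matrix.norm_le_iff (norm_nonneg a)]
  exact forall₂_congr fun i j => valuation_le_iff_norm_le

/-- `ValBound 1 X ↔ ‖X‖ ≤ 1` (integral matrices). [folklore] -/
theorem valBound_one_iff_norm_le_one (X : Matrix m m F) : ValBound 1 X ↔ ‖X‖ ≤ 1 := by
  rw [← (ValuativeRel.valuation F).map_one, valBound_valuation_iff_norm_le, norm_one]

/-- `ValBound (v ϖ ^ k) X ↔ ‖X‖ ≤ ‖ϖ‖ ^ k`. [cite: HarishChandra1999AdmissibleDistributions, §17 p. 80] -/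
theorem valBound_pow_iff_norm_le (ϖ : F) (k : ℕ) (X : Matrix m m F) : ValBound (ValuativeRel.valuation F ϖ ^ k) X ↔ ‖X‖ ≤ ‖ϖ‖ ^ k := by
  rw [← map_pow, valBound_valuation_iff_norm_le, norm_pow]

/-- **`ValBound (v ϖ ^ k) X ↔ ‖X‖ ≤ (q ^ k)⁻¹`**, `q = ‖ϖ‖⁻¹`. [cite: HarishChandra1999AdmissibleDistributions, §17 p. 80] -/
theorem valBound_pow_iff_norm_le_inv_pow (ϖ : F) (k : ℕ) (X : Matrix m m F) : ValBound (ValuativeRel.valuation F ϖ ^ k) X ↔ ‖X‖ ≤ (‖ϖ‖⁻¹ ^ k)⁻¹ := by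
  rw [valBound_pow_iff_norm_le, norm_pow_eq_inv_pow_inv]

/-- **`ValBound (v ϖ ^ k)⁻¹ X ↔ ‖X‖ ≤ q ^ k`**, `q = ‖ϖ‖⁻¹` (the shape of `hnd`'s ∕ `hint`'s ∕ `hocc`'s bounds in ★ p855853). [cite: HarishChandra1999AdmissibleDistributions, §17 p. 80] -/
theorem valBound_pow_inv_iff_norm_le (ϖ : F) (k : ℕ) (X : Matrix m m F) : ValBound (ValuativeRel.valuation F ϖ ^ k)⁻¹ X ↔ ‖X‖ ≤ ‖ϖ‖⁻¹ ^ k := by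
  rw [← map_pow, ← map_inv₀, valBound_valuation_iff_norm_le, norm_inv, norm_pow, inv_pow]

omit [ValuativeRel F] [(Valued.v : Valuation F Γ₀).Compatible] in
/-- `IsUltrametricDist` for the elementwise sup norm on matrices over `F` (Mathlib `Pi` instances), recorded as a theorem for `haveI`. [folklore] -/
theorem isUltrametricDist_matrix {p q : Type*} [Fintype p] [Fintype q] : IsUltrametricDist (Matrix p q F) :=
  inferInstanceAs (IsUltrametricDist (p → q → F))

end MatrixBounds

/-! ## §3 `GL_n(𝒪)` and the congruence subgroups `K_m` in norms -/

section Groups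

variable {F : Type*} [Field F] [ValuativeRel F] {Γ₀ : Type*} [LinearOrderedCommGroupWithZero Γ₀] [Valued F Γ₀]
  [(Valued.v : Valuation F Γ₀).Compatible] [(Valued.v : Valuation F Γ₀).RankOne] {n : ℕ}

/-- **`k ∈ GL_n(𝒪) ↔ ‖k‖ ≤ 1 ∧ ‖k⁻¹‖ ≤ 1`** (★ `mem_glInt_iff`). [cite: Casselman1995, §1.4] -/
theorem mem_glInt_iff_norm_le_one (k : GL (Fin n) F) :
    k ∈ glInt n F ↔ ‖(k : Matrix (Fin n) (Fin n) F)‖ ≤ 1 ∧ ‖((k⁻¹ : GL (Fin n) F) : Matrix (Fin n) (Fin n) F)‖ ≤ 1 := by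
  rw [mem_glInt_iff, Matrix.norm_le_iff zero_le_one, Matrix.norm_le_iff zero_le_one]
  exact and_congr (forall₂_congr fun i j => mem_integer_iff_norm_le_one) (forall₂_congr fun i j => mem_integer_iff_norm_le_one)

/-- `k ∈ congruenceGL n (v a) ↔ (‖k‖ ≤ 1 ∧ ‖k⁻¹‖ ≤ 1) ∧ ‖k − 1‖ ≤ ‖a‖ ∧ ‖k⁻¹ − 1‖ ≤ ‖a‖` (★ `mem_congruenceGL_iff`). [cite: Casselman1995, §1.4] -/
theorem mem_congruenceGL_valuation_iff_norm (a : F) (k : GL (Fin n) F) :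
    k ∈ congruenceGL n (ValuativeRel.valuation F a) ↔
      (‖(k : Matrix (Fin n) (Fin n) F)‖ ≤ 1 ∧ ‖((k⁻¹ : GL (Fin n) F) : Matrix (Fin n) (Fin n) F)‖ ≤ 1) ∧
        ‖(k : Matrix (Fin n) (Fin n) F) - 1‖ ≤ ‖a‖ ∧ ‖((k⁻¹ : GL (Fin n) F) : Matrix (Fin n) (Fin n) F) - 1‖ ≤ ‖a‖ := by
  rw [mem_congruenceGL_iff, valBound_one_iff_norm_le_one, valBound_one_iff_norm_le_one, valBound_valuation_iff_norm_le, valBound_valuation_iff_norm_le]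

/-- **`k ∈ K_m ↔ (‖k‖ ≤ 1 ∧ ‖k⁻¹‖ ≤ 1) ∧ ‖k − 1‖ ≤ ‖ϖ‖^m ∧ ‖k⁻¹ − 1‖ ≤ ‖ϖ‖^m`**, `K_m = congruenceGL n (v ϖ ^ m)` (the levels of ★ p855816 `frame_pack`).
[cite: HarishChandra1999AdmissibleDistributions, §17 p. 80] [cite: Casselman1995, §1.4] -/
theorem mem_congruenceGL_pow_iff_norm (ϖ : F) (m : ℕ) (k : GL (Fin n) F) :
    k ∈ congruenceGL n (ValuativeRel.valuation F ϖ ^ m) ↔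
      (‖(k : Matrix (Fin n) (Fin n) F)‖ ≤ 1 ∧ ‖((k⁻¹ : GL (Fin n) F) : Matrix (Fin n) (Fin n) F)‖ ≤ 1) ∧
        ‖(k : Matrix (Fin n) (Fin n) F) - 1‖ ≤ ‖ϖ‖ ^ m ∧ ‖((k⁻¹ : GL (Fin n) F) : Matrix (Fin n) (Fin n) F) - 1‖ ≤ ‖ϖ‖ ^ m := by
  rw [← map_pow, mem_congruenceGL_valuation_iff_norm, norm_pow]

/-- **The forward packet for `k ∈ K_m`** in the `q`-spelling (`q = ‖ϖ‖⁻¹`): `‖k − 1‖ ≤ (q^m)⁻¹`, `‖k⁻¹ − 1‖ ≤ (q^m)⁻¹`, `‖k‖ ≤ 1`, `‖k⁻¹‖ ≤ 1` — the inputs of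
★ `norm_conj_sub_le_of_le` (isometry ∕ contraction of `Ad k`) and of the L6 validity radius. [cite: HarishChandra1999AdmissibleDistributions, §17 p. 80] -/
theorem norm_bounds_of_mem_congruenceGL_pow {ϖ : F} {m : ℕ} {k : GL (Fin n) F} (hk : k ∈ congruenceGL n (ValuativeRel.valuation F ϖ ^ m)) :
    ‖(k : Matrix (Fin n) (Fin n) F) - 1‖ ≤ (‖ϖ‖⁻¹ ^ m)⁻¹ ∧ ‖((k⁻¹ : GL (Fin n) F) : Matrix (Fin n) (Fin n) F) - 1‖ ≤ (‖ϖ‖⁻¹ ^ m)⁻¹ ∧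
      ‖(k : Matrix (Fin n) (Fin n) F)‖ ≤ 1 ∧ ‖((k⁻¹ : GL (Fin n) F) : Matrix (Fin n) (Fin n) F)‖ ≤ 1 := by
  rw [mem_congruenceGL_pow_iff_norm, norm_pow_eq_inv_pow_inv] at hk
  exact ⟨hk.2.1, hk.2.2, hk.1.1, hk.1.2⟩

/-- `k ∈ GL_n(𝒪) ⇒ ‖k‖ ≤ 1 ∧ ‖k⁻¹‖ ≤ 1` (forward form of `mem_glInt_iff_norm_le_one`, for `K₁ ≤ e⁻¹ GL_n(𝒪)` in `hiso` ∕ `hcontr`). [cite: Casselman1995, §1.4] -/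
theorem norm_le_one_of_mem_glInt {k : GL (Fin n) F} (hk : k ∈ glInt n F) :
    ‖(k : Matrix (Fin n) (Fin n) F)‖ ≤ 1 ∧ ‖((k⁻¹ : GL (Fin n) F) : Matrix (Fin n) (Fin n) F)‖ ≤ 1 :=
  (mem_glInt_iff_norm_le_one k).1 hk

end Groups

/-! ## §4 At a place: `L_w = w.adicCompletion L` -/

section AdicCompletion

open IsDedekindDomain NumberField

variable (L : Type*) [Field L] [NumberField L] (w : HeightOneSpectrum (𝓞 L))

/-- `L_w` has characteristic zero (`algebraMap L L_w` is injective). [folklore] -/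
theorem charZero_adicCompletion : CharZero (w.adicCompletion L) :=
  charZero_of_injective_algebraMap (algebraMap L (w.adicCompletion L)).injective

/-- `L_w` is a perfect field (characteristic zero; the binder behind `charpoly` separability in ★ L6-inst). [folklore] -/
theorem perfectField_adicCompletion : PerfectField (w.adicCompletion L) := by
  haveI := charZero_adicCompletion L w
  infer_instance

/-- `1 < q_w := ‖ϖ‖⁻¹` at `L_w` for any `ϖ ≠ 0` of valuation `< 1` (§1 at the place; with Mathlib `instRankOneAdicCompletion` the norm is `Valued.toNormedField`'s).
[cite: WeilBNT1967, Ch. I §4] -/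
theorem one_lt_inv_norm_adicCompletion {ϖ : w.adicCompletion L} (h0 : ϖ ≠ 0) (h1 : ValuativeRel.valuation (w.adicCompletion L) ϖ < 1) : 1 < ‖ϖ‖⁻¹ :=
  one_lt_inv_norm h0 h1

end AdicCompletion

/-! ## §5 (ED. 2) The dictionary clauses of ★ `K2E3LevelTraceStableAtPlaceGL.exists_levelTraceStable_GL` DISCHARGED at `q := ‖ϖ‖⁻¹`:
`hiso`, `hcontr`, `hδm` for any frame `e : G ≃ₜ* GL_n(F)` (and `hval` = §0 `exists_ne_zero_and_norm_eq`) -/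

section Isometry

variable {K : Type*} [NontriviallyNormedField K] [IsUltrametricDist K] {N : ℕ}

/-- **`Ad k` is an isometry of `(M_N(K), ‖·‖_sup)` when `‖k‖ ≤ 1` and `‖k⁻¹‖ ≤ 1`** (`‖kXk⁻¹‖ ≤ ‖k‖‖X‖‖k⁻¹‖ ≤ ‖X‖` and symmetrically for `X = k⁻¹(kXk⁻¹)k`;
★ `norm_mul_le_of_isUltrametricDist`). [cite: HarishChandra1999AdmissibleDistributions, §17 p. 80] -/
theorem norm_conj_eq_of_norm_le_one (k : GL (Fin N) K) (hk : ‖(k : Matrix (Fin N) (Fin N) K)‖ ≤ 1) (hk' : ‖((k⁻¹ : GL (Fin N) K) : Matrix (Fin N) (Fin N) K)‖ ≤ 1)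
    (X : Matrix (Fin N) (Fin N) K) : ‖(k : Matrix (Fin N) (Fin N) K) * X * ((k⁻¹ : GL (Fin N) K) : Matrix (Fin N) (Fin N) K)‖ = ‖X‖ := by
  have key : ∀ (a b : GL (Fin N) K), ‖(a : Matrix (Fin N) (Fin N) K)‖ ≤ 1 → ‖(b : Matrix (Fin N) (Fin N) K)‖ ≤ 1 →
      ∀ Y : Matrix (Fin N) (Fin N) K, ‖(a : Matrix (Fin N) (Fin N) K) * Y * (b : Matrix (Fin N) (Fin N) K)‖ ≤ ‖Y‖ := by
    intro a b ha hb Y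
    calc ‖(a : Matrix (Fin N) (Fin N) K) * Y * (b : Matrix (Fin N) (Fin N) K)‖
        ≤ ‖(a : Matrix (Fin N) (Fin N) K) * Y‖ * ‖(b : Matrix (Fin N) (Fin N) K)‖ := Literature.Analysis.Matrix.norm_mul_le_of_isUltrametricDist _ _
      _ ≤ (‖(a : Matrix (Fin N) (Fin N) K)‖ * ‖Y‖) * 1 :=
          mul_le_mul (Literature.Analysis.Matrix.norm_mul_le_of_isUltrametricDist _ _) hb (norm_nonneg _) (mul_nonneg (norm_nonneg _) (norm_nonneg _))
      _ ≤ (1 * ‖Y‖) * 1 := by gcongr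
      _ = ‖Y‖ := by rw [one_mul, mul_one]
  refine le_antisymm (key k k⁻¹ hk hk' X) ?_
  have e : X = ((k⁻¹ : GL (Fin N) K) : Matrix (Fin N) (Fin N) K) * ((k : Matrix (Fin N) (Fin N) K) * X * ((k⁻¹ : GL (Fin N) K) : Matrix (Fin N) (Fin N) K)) *
      (k : Matrix (Fin N) (Fin N) K) := by
    have h1 : ((k⁻¹ : GL (Fin N) K) : Matrix (Fin N) (Fin N) K) * (k : Matrix (Fin N) (Fin N) K) = 1 := by rw [← Units.val_mul, inv_mul_cancel, Units.val_one]
    rw [← Matrix.mul_assoc, ← Matrix.mul_assoc, h1, Matrix.one_mul, Matrix.mul_assoc, h1, Matrix.mul_one]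
  conv_lhs => rw [e]
  exact key k⁻¹ k hk' hk _

end Isometry

section AssemblyClauses

variable {F : Type*} [Field F] [ValuativeRel F] {Γ₀ : Type*} [LinearOrderedCommGroupWithZero Γ₀] [Valued F Γ₀]
  [(Valued.v : Valuation F Γ₀).Compatible] [(Valued.v : Valuation F Γ₀).RankOne] {n : ℕ}
  {G : Type*} [Group G] [TopologicalSpace G] (e : G ≃ₜ* GL (Fin n) F)

/-- **Clause `hiso`** of ★ `exists_levelTraceStable_GL`, VERBATIM: `Ad(e x)` is an isometry for `x ∈ e⁻¹ K_0 = e⁻¹ GL_n(𝒪)`. [cite: HarishChandra1999AdmissibleDistributions, §17 p. 80] -/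
theorem clause_hiso (ϖ : F) :
    ∀ x ∈ (congruenceGL n (ValuativeRel.valuation F ϖ ^ 0)).comap e.toMulEquiv.toMonoidHom, ∀ X : Matrix (Fin n) (Fin n) F,
      ‖((e x : GL (Fin n) F) : Matrix (Fin n) (Fin n) F) * X * ((e x)⁻¹ : GL (Fin n) F)‖ = ‖X‖ := by
  intro x hx X
  have hb := norm_bounds_of_mem_congruenceGL_pow (Subgroup.mem_comap.1 hx : (e x : GL (Fin n) F) ∈ congruenceGL n (ValuativeRel.valuation F ϖ ^ 0))
  exact norm_conj_eq_of_norm_le_one (e x) hb.2.2.1 hb.2.2.2 X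

/-- **Clause `hcontr`** of ★ `exists_levelTraceStable_GL` at `q := ‖ϖ‖⁻¹`, VERBATIM: `‖Ad(e x) X − X‖ ≤ (q^ν)⁻¹ ‖X‖` for `x ∈ e⁻¹ K_ν` (★ `norm_conj_sub_le_of_le` + §3).
[cite: HarishChandra1999AdmissibleDistributions, §19 p. 81 (2)] -/
theorem clause_hcontr (ϖ : F) :
    ∀ ν : ℕ, ∀ x ∈ (congruenceGL n (ValuativeRel.valuation F ϖ ^ ν)).comap e.toMulEquiv.toMonoidHom, ∀ X : Matrix (Fin n) (Fin n) F,
      ‖((e x : GL (Fin n) F) : Matrix (Fin n) (Fin n) F) * X * ((e x)⁻¹ : GL (Fin n) F) - X‖ ≤ (‖ϖ‖⁻¹ ^ ν)⁻¹ * ‖X‖ := by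
  intro ν x hx X
  have hb := norm_bounds_of_mem_congruenceGL_pow (Subgroup.mem_comap.1 hx : (e x : GL (Fin n) F) ∈ congruenceGL n (ValuativeRel.valuation F ϖ ^ ν))
  exact K2E3RegularAdjointConeEstimates.norm_conj_sub_le_of_le (e x) hb.1 hb.2.2.2 X

/-- **Clause `hδm`** of ★ `exists_levelTraceStable_GL`, VERBATIM: for every `δ > 0` some level `K_m` has `‖e t − 1‖ < δ` and `‖(e t)⁻¹‖ ≤ 1` on `e⁻¹ K_m`
(`‖ϖ‖^m → 0` as `‖ϖ‖ < 1`, §3). [cite: HarishChandra1999AdmissibleDistributions, §17 p. 80] -/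
theorem clause_hδm {ϖ : F} (h1 : ValuativeRel.valuation F ϖ < 1) :
    ∀ δ : ℝ, 0 < δ → ∃ m : ℕ, ∀ t ∈ (congruenceGL n (ValuativeRel.valuation F ϖ ^ m)).comap e.toMulEquiv.toMonoidHom,
      ‖((e t : GL (Fin n) F) : Matrix (Fin n) (Fin n) F) - 1‖ < δ ∧ ‖(((e t)⁻¹ : GL (Fin n) F) : Matrix (Fin n) (Fin n) F)‖ ≤ 1 := by
  intro δ hδ
  have hϖ1 : ‖ϖ‖ < 1 := valuation_lt_one_iff_norm_lt_one.1 h1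
  obtain ⟨m, hm⟩ := exists_pow_lt_of_lt_one hδ hϖ1
  refine ⟨m, fun t ht => ?_⟩
  have hb := norm_bounds_of_mem_congruenceGL_pow (Subgroup.mem_comap.1 ht : (e t : GL (Fin n) F) ∈ congruenceGL n (ValuativeRel.valuation F ϖ ^ m))
  rw [← norm_pow_eq_inv_pow_inv] at hb
  exact ⟨hb.1.trans_lt hm, hb.2.2.2⟩

/-- The same clause for a uniformizing element (★ `IsUniformizingElement`, the assembly's `hϖ`). [cite: HarishChandra1999AdmissibleDistributions, §17 p. 80] -/
theorem clause_hδm_of_isUniformizingElement {ϖ : F} (hϖ : IsUniformizingElement ϖ) :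
    ∀ δ : ℝ, 0 < δ → ∃ m : ℕ, ∀ t ∈ (congruenceGL n (ValuativeRel.valuation F ϖ ^ m)).comap e.toMulEquiv.toMonoidHom,
      ‖((e t : GL (Fin n) F) : Matrix (Fin n) (Fin n) F) - 1‖ < δ ∧ ‖(((e t)⁻¹ : GL (Fin n) F) : Matrix (Fin n) (Fin n) F)‖ ≤ 1 :=
  clause_hδm e hϖ.valuation_lt_one

/-- **Clause `hdict`** of ★ p855953 `K2E3ParameterPackageGL` (`paramGL_hnd` ∕ `_hint` ∕ `_hocc`), VERBATIM at `q := ‖ϖ‖⁻¹`. [cite: HarishChandra1999AdmissibleDistributions, §17 p. 80] -/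
theorem clause_hdict (ϖ : F) : ∀ (m : ℕ) (X : Matrix (Fin n) (Fin n) F), ValBound (ValuativeRel.valuation F ϖ ^ m)⁻¹ X ↔ ‖X‖ ≤ ‖ϖ‖⁻¹ ^ m :=
  fun m X => valBound_pow_inv_iff_norm_le ϖ m X

/-- **Clause `hint1`** of ★ p855953 (`paramGL_hiso` ∕ `_hcontr`), VERBATIM: `k ∈ GL_n(𝒪) → ‖k‖ ≤ 1`. [cite: Casselman1995, §1.4] -/
theorem clause_hint1 : ∀ k : GL (Fin n) F, k ∈ glInt n F → ‖(k : Matrix (Fin n) (Fin n) F)‖ ≤ 1 :=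
  fun _ hk => (norm_le_one_of_mem_glInt hk).1

/-- **Clause `hlev`** of ★ p855953 (`paramGL_hcontr`), VERBATIM at `q := ‖ϖ‖⁻¹`: `k ∈ K_m → ‖k − 1‖ ≤ (q^m)⁻¹`. [cite: HarishChandra1999AdmissibleDistributions, §17 p. 80] -/
theorem clause_hlev (ϖ : F) : ∀ (m : ℕ) (k : GL (Fin n) F), k ∈ congruenceGL n (ValuativeRel.valuation F ϖ ^ m) → ‖(k : Matrix (Fin n) (Fin n) F) - 1‖ ≤ (‖ϖ‖⁻¹ ^ m)⁻¹ :=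
  fun _ _ hk => (norm_bounds_of_mem_congruenceGL_pow hk).1

end AssemblyClauses

end Summit.HodgeConjecture.HodgeConjecture.Cruxes.H413.K2E3LocalFieldNormDictionary

end
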